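import Summits.CriticalPhenomena.SAWScalingLimit.Theorems.SAWTwistedSelfEnergySubseqIdentificationParaDoobMartingaleWalks
import Literature.Probability.RandomPlanarGeometry.DiagonalDressedSAW
import HarnessLib

/-!
# `stub_paraDoobMartingale` (S1 of the line `parafermionic-martingale`, crux `SubseqIdentification`,
stmt-CriticalPhenomena-0783): the Doob-normalised parafermionic observable is an exact exploration
martingale

Registered stub `stub_paraDoobMartingale` of the skeleton
`Summits/CriticalPhenomena/SAWScalingLimit/Cruxes/SubseqIdentification/Lines/parafermionic_martingale.lean`
(objects in `Theorems/SAWTwistedSelfEnergyParaMartingaleDefs.lean`: `contObs = A(l, z)`,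
`contPartition = B(l)`, `pastObs = M(l, z) = A(l, z)/B(l)`, `paraDoob = Q_n = M(γ[0,n], z)/M(γ[0,0], z)`;
walk bookkeeping in `Theorems/SAWTwistedSelfEnergySubseqIdentificationParaDoobMartingaleWalks.lean`).

**Statement.** For the critical SAW law `P_δ(γ) ∝ x_c^{|γ|}` of `(D; a, b)` at mesh `δ > 0`, a vertex
`z`, a step `n` and a vertex list `l` of the cylinder `C(l) = {γ | γ[0,n] = l}` with `z ∉ l`, under the
NO-DEAD-STEP hypothesis (every neighbour `u ∉ l` of the tip of `l` from which `z` can be reached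
avoiding `l` can also reach `b` avoiding `l`):
`∫_{C(l)} Q_{n+1} dP_δ = ∫_{C(l)} Q_n dP_δ`.

**Proof** (first-step decomposition + domain Markov property, all sums finite).
* The time-`0` denominator `M(γ[0,0], z)` only sees the support `[a]` of the trivial past, so it is a
  constant and factors out (`SAW.apply_eq_of_support_eq`); integrals against `SAW.law` on the finite
  SAW space are normalised weighted sums (`setIntegral_law_eq_of_sum_eq`), so the claim is the identity
  `Σ_{γ ∈ C(l)} x_c^{|γ|} M(γ[0,n+1], z) = Σ_{γ ∈ C(l)} x_c^{|γ|} M(γ[0,n], z)` (`sum_cyl_pastObs_succ_eq`).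
* By gluing, `M(L, z) = A♯(l)/B♯(l)` with the CYLINDER sums `A♯(m) = Σ_{η : a → z, η ⊒ m} x_c^{|η|}
  e^{-i(5/8)W(a' → η)}`, `B♯(m) = Σ_{γ : a → b, γ ⊒ m} x_c^{|γ|}` (`pastObs_prefixAt_eq`).
* If `b ∈ l` every walk of `C(l)` IS `l` and both pasts are the whole walk (pointwise equality,
  `sum_cyl_pastObs_succ_eq_of_mem`). Otherwise (`sum_cyl_pastObs_succ_eq_of_not_mem`) the right side is
  `B♯(l) · A♯(l)/B♯(l) = A♯(l)`, and grouping the left side by the `(n+2)`-prefix `m` of `γ` gives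
  `Σ_m B♯(m) A♯(m)/B♯(m) = Σ_{m ∈ I_b} A♯(m)`, `I_b` the set of `(n+2)`-prefixes of walks `a → b`
  through `l`; while `A♯(l) = Σ_{m ∈ I_z} A♯(m)` over the `(n+2)`-prefixes of walks `a → z` through `l`
  (first-step decomposition). The no-dead-step hypothesis is exactly `I_z ⊆ I_b`
  (`exists_take_eq_of_noDeadStep`), and `A♯` vanishes off `I_z`.

Sources: G. F. Lawler, O. Schramm, W. Werner, Proc. Sympos. Pure Math. 72 (2004) §3.4.2 (domain
Markov property of the critical SAW measure); H. Duminil-Copin, S. Smirnov, Ann. of Math. 175 (2012)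
§2 (the parafermionic observable and its vertex relation); N. Madras, G. Slade (1993) §1.2
(concatenation). No new definitions, no named facts.
-/

noncomputable section

open MeasureTheory Filter Topology Set
open scoped NNReal ENNReal Classical BigOperators
open Literature.Probability.LatticeModels
open Literature.Probability.RandomPlanarGeometry
open UpperHalfPlane (upperHalfPlaneSet)

namespace Summit.CriticalPhenomena.SAWScalingLimit.Theorems.SubseqIdentification.ParaMartingale

open Summit.CriticalPhenomena.SAWScalingLimit.Theorems.SubseqIdentification.RoomEntropy (prefixAt)

/-! ## The core identity -/

/-- **Case `b ∈ l`**: every walk of the cylinder `C(l)` has length `≤ n`, so both pasts `γ[0,n+1]`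
and `γ[0,n]` are the whole walk and the two weighted sums agree term by term. [folklore] -/
theorem sum_cyl_pastObs_succ_eq_of_mem {Ω : Set ℂ} {δ : ℝ}
    [∀ u w : Site 2, Fintype (SAW.DomainSAW Ω δ u w)]
    {a b : Site 2} (a' z : Site 2) {n : ℕ} {l : List (Site 2)} (hb : b ∈ l) :
    (∑ γ : SAW.DomainSAW Ω δ a b, if γ.walk.support.take (n + 1) = l then
        (SAW.criticalFugacity : ℂ) ^ γ.length * pastObs Ω δ a' b (prefixAt γ (n + 1)) z else 0) =
      ∑ γ : SAW.DomainSAW Ω δ a b, if γ.walk.support.take (n + 1) = l then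
        (SAW.criticalFugacity : ℂ) ^ γ.length * pastObs Ω δ a' b (prefixAt γ n) z else 0 := by
  refine Finset.sum_congr rfl fun γ _ => ?_
  split_ifs with hγ
  · have hlen : γ.walk.length ≤ n := by
      by_contra hlt
      push Not at hlt
      have hnd : γ.walk.support.Nodup := (SimpleGraph.Walk.isPath_def _).1 γ.isPath
      have hne : γ.walk.support.drop (n + 1) ≠ [] := by
        rw [ne_eq, List.drop_eq_nil_iff, SimpleGraph.Walk.length_support]
        omega
      have hbd : b ∈ γ.walk.support.drop (n + 1) := by
        have h := List.getLast_mem hne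
        rwa [List.getLast_drop, SimpleGraph.Walk.getLast_support] at h
      rw [← hγ] at hb
      exact List.disjoint_take_drop hnd le_rfl hb hbd
    congr 1
    refine SAW.apply_eq_of_support_eq
      (F := fun w (p : (discreteDomainGraph Ω δ).Walk a w) => pastObs Ω δ a' b p z) ?_
    show (γ.walk.takeUntil _ _).support = (γ.walk.takeUntil _ _).support
    rw [SAW.support_takeUntil_getVert_of_length_le γ.isPath (by omega : γ.walk.length ≤ n + 1),
      SAW.support_takeUntil_getVert_of_length_le γ.isPath hlen]
  · rfl

/-- **Case `b ∉ l`** (the heart of S1): with `A♯`, `B♯` the cylinder sums, the right side is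
`B♯(l) · A♯(l)/B♯(l) = A♯(l) = Σ_{m ∈ I_z} A♯(m)` (first-step decomposition over the
`(n+2)`-prefixes `m` of walks `a → z` through `l`), the left side is `Σ_{m ∈ I_b} B♯(m) A♯(m)/B♯(m)
= Σ_{m ∈ I_b} A♯(m)` (domain Markov property over the `(n+2)`-prefixes of walks `a → b` through
`l`), `I_z ⊆ I_b` by the no-dead-step hypothesis and `A♯ = 0` off `I_z`. [folklore] -/
theorem sum_cyl_pastObs_succ_eq_of_not_mem {Ω : Set ℂ} {δ : ℝ}
    [∀ u w : Site 2, Fintype (SAW.DomainSAW Ω δ u w)]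
    {a b z : Site 2} (a' : Site 2) {n : ℕ} {l : List (Site 2)} (hz : z ∉ l) (hb : b ∉ l)
    (H : ∀ v u : Site 2, l.getLast? = some v → (discreteDomainGraph Ω δ).Adj v u → u ∉ l →
      (∃ ω : SAW.DomainSAW Ω δ u z, ∀ y ∈ ω.walk.support, y ∉ l) →
      ∃ ω : SAW.DomainSAW Ω δ u b, ∀ y ∈ ω.walk.support, y ∉ l) :
    (∑ γ : SAW.DomainSAW Ω δ a b, if γ.walk.support.take (n + 1) = l then
        (SAW.criticalFugacity : ℂ) ^ γ.length * pastObs Ω δ a' b (prefixAt γ (n + 1)) z else 0) =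
      ∑ γ : SAW.DomainSAW Ω δ a b, if γ.walk.support.take (n + 1) = l then
        (SAW.criticalFugacity : ℂ) ^ γ.length * pastObs Ω δ a' b (prefixAt γ n) z else 0 := by
  -- notation: `X = x_c`, the phase `ph`, the cylinder sums `A = A♯`, `B = B♯` at level `n + 2`
  -- and `A₁ = A♯(l)`, `B₁ = B♯(l)` at level `n + 1`
  set X : ℂ := (SAW.criticalFugacity : ℂ) with hX
  set ph : List (Site 2) → ℂ := fun s =>
    Complex.exp (-Complex.I * (5 / 8 : ℂ) * (winding (meshPoint δ a' :: (s.map (meshPoint δ))) : ℝ))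
    with hph
  set A : List (Site 2) → ℂ := fun m => ∑ η : SAW.DomainSAW Ω δ a z,
    if η.walk.support.take (n + 2) = m then X ^ η.length * ph η.walk.support else 0 with hA
  set B : List (Site 2) → ℂ := fun m => ∑ γ : SAW.DomainSAW Ω δ a b,
    if γ.walk.support.take (n + 2) = m then X ^ γ.length else 0 with hB
  set A₁ : ℂ := ∑ η : SAW.DomainSAW Ω δ a z,
    if η.walk.support.take (n + 1) = l then X ^ η.length * ph η.walk.support else 0 with hA₁
  set B₁ : ℂ := ∑ γ : SAW.DomainSAW Ω δ a b,
    if γ.walk.support.take (n + 1) = l then X ^ γ.length else 0 with hB₁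
  -- Step 1: the pasts of a walk of the cylinder, read through the cylinder sums
  have hlenγ : ∀ γ : SAW.DomainSAW Ω δ a b, γ.walk.support.take (n + 1) = l →
      n + 1 ≤ γ.walk.length := by
    intro γ hγ
    by_contra hlt
    push Not at hlt
    apply hb
    rw [← hγ, List.take_of_length_le
      (show γ.walk.support.length ≤ n + 1 by rw [SimpleGraph.Walk.length_support]; omega)]
    exact γ.walk.end_mem_support
  have hM0 : ∀ γ : SAW.DomainSAW Ω δ a b, γ.walk.support.take (n + 1) = l →
      pastObs Ω δ a' b (prefixAt γ n) z = A₁ / B₁ := by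
    intro γ hγ
    have h := pastObs_prefixAt_eq a' z γ (show n ≤ γ.walk.length by have := hlenγ γ hγ; omega)
    rw [hγ] at h
    exact h
  have hM1 : ∀ γ : SAW.DomainSAW Ω δ a b, γ.walk.support.take (n + 1) = l →
      pastObs Ω δ a' b (prefixAt γ (n + 1)) z =
        A (γ.walk.support.take (n + 2)) / B (γ.walk.support.take (n + 2)) :=
    fun γ hγ => pastObs_prefixAt_eq a' z γ (hlenγ γ hγ)
  -- the empty cylinder
  by_cases hC : ∃ γ₁ : SAW.DomainSAW Ω δ a b, γ₁.walk.support.take (n + 1) = l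
  swap
  · push Not at hC
    have h0 : ∀ F : SAW.DomainSAW Ω δ a b → ℂ,
        (∑ γ : SAW.DomainSAW Ω δ a b, if γ.walk.support.take (n + 1) = l then F γ else 0) = 0 :=
      fun F => Finset.sum_eq_zero fun γ _ => if_neg (hC γ)
    rw [h0, h0]
  obtain ⟨γ₁, hγ₁⟩ := hC
  -- Step 2: the right-hand side is `A₁`
  have hB₁ : B₁ ≠ 0 :=
    sum_ite_pow_ne_zero (fun γ : SAW.DomainSAW Ω δ a b => γ.walk.support.take (n + 1) = l)
      (fun γ => γ.length) hγ₁
  have eR : (∑ γ : SAW.DomainSAW Ω δ a b, if γ.walk.support.take (n + 1) = l then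
      X ^ γ.length * pastObs Ω δ a' b (prefixAt γ n) z else 0) = A₁ := by
    calc _ = ∑ γ : SAW.DomainSAW Ω δ a b,
          (if γ.walk.support.take (n + 1) = l then X ^ γ.length else 0) * (A₁ / B₁) :=
          Finset.sum_congr rfl fun γ _ => by
            split_ifs with hγ
            · rw [hM0 γ hγ]
            · rw [zero_mul]
      _ = B₁ * (A₁ / B₁) := (Finset.sum_mul _ _ _).symm
      _ = A₁ := by rw [← mul_div_assoc, mul_div_cancel_left₀ _ hB₁]
  rw [eR]
  -- Step 3: the left-hand side, fibrewise over the `(n+2)`-prefix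
  have hBne : ∀ γ₀ : SAW.DomainSAW Ω δ a b, B (γ₀.walk.support.take (n + 2)) ≠ 0 := fun γ₀ =>
    sum_ite_pow_ne_zero (fun γ : SAW.DomainSAW Ω δ a b =>
      γ.walk.support.take (n + 2) = γ₀.walk.support.take (n + 2)) (fun γ => γ.length) rfl
  set CF : Finset (SAW.DomainSAW Ω δ a b) :=
    Finset.univ.filter fun γ => γ.walk.support.take (n + 1) = l with hCF
  have efib : ∀ γ₁ ∈ CF, A (γ₁.walk.support.take (n + 2)) =
      ∑ γ ∈ CF with γ.walk.support.take (n + 2) = γ₁.walk.support.take (n + 2),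
        X ^ γ.length * (A (γ.walk.support.take (n + 2)) / B (γ.walk.support.take (n + 2))) := by
    intro γ₁ hγ₁
    have hp₁ : γ₁.walk.support.take (n + 1) = l := (Finset.mem_filter.1 hγ₁).2
    have hfib : (CF.filter fun γ => γ.walk.support.take (n + 2) = γ₁.walk.support.take (n + 2)) =
        Finset.univ.filter fun γ : SAW.DomainSAW Ω δ a b =>
          γ.walk.support.take (n + 2) = γ₁.walk.support.take (n + 2) := by
      ext γ
      simp only [hCF, Finset.mem_filter, Finset.mem_univ, true_and, and_iff_right_iff_imp]
      exact fun hγ => take_eq_of_take_succ_eq hp₁ hγ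
    have hBfib : B (γ₁.walk.support.take (n + 2)) =
        ∑ γ ∈ CF with γ.walk.support.take (n + 2) = γ₁.walk.support.take (n + 2), X ^ γ.length := by
      rw [hfib, Finset.sum_filter]
    calc A (γ₁.walk.support.take (n + 2))
        = B (γ₁.walk.support.take (n + 2)) *
            (A (γ₁.walk.support.take (n + 2)) / B (γ₁.walk.support.take (n + 2))) := by
          rw [← mul_div_assoc, mul_div_cancel_left₀ _ (hBne γ₁)]
      _ = ∑ γ ∈ CF with γ.walk.support.take (n + 2) = γ₁.walk.support.take (n + 2),
            X ^ γ.length *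
              (A (γ₁.walk.support.take (n + 2)) / B (γ₁.walk.support.take (n + 2))) := by
          rw [hBfib, Finset.sum_mul]
      _ = _ := Finset.sum_congr rfl fun γ hγ => by rw [(Finset.mem_filter.1 hγ).2]
  have eL : (∑ γ : SAW.DomainSAW Ω δ a b, if γ.walk.support.take (n + 1) = l then
      X ^ γ.length * pastObs Ω δ a' b (prefixAt γ (n + 1)) z else 0) =
      ∑ m ∈ CF.image (fun γ => γ.walk.support.take (n + 2)), A m := by
    rw [Finset.sum_image' (fun γ : SAW.DomainSAW Ω δ a b => X ^ γ.length *
      (A (γ.walk.support.take (n + 2)) / B (γ.walk.support.take (n + 2)))) efib, hCF,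
      Finset.sum_filter]
    refine Finset.sum_congr rfl fun γ _ => ?_
    split_ifs with hγ
    · rw [hM1 γ hγ]
    · rfl
  rw [eL]
  -- Step 4: `A₁` fibrewise, and comparison of the two index sets of prefixes
  set CzF : Finset (SAW.DomainSAW Ω δ a z) :=
    Finset.univ.filter fun η => η.walk.support.take (n + 1) = l with hCzF
  have ezfib : ∀ η₁ ∈ CzF, A (η₁.walk.support.take (n + 2)) =
      ∑ η ∈ CzF with η.walk.support.take (n + 2) = η₁.walk.support.take (n + 2),
        X ^ η.length * ph η.walk.support := by
    intro η₁ hη₁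
    have hp₁ : η₁.walk.support.take (n + 1) = l := (Finset.mem_filter.1 hη₁).2
    have hfib : (CzF.filter fun η => η.walk.support.take (n + 2) = η₁.walk.support.take (n + 2)) =
        Finset.univ.filter fun η : SAW.DomainSAW Ω δ a z =>
          η.walk.support.take (n + 2) = η₁.walk.support.take (n + 2) := by
      ext η
      simp only [hCzF, Finset.mem_filter, Finset.mem_univ, true_and, and_iff_right_iff_imp]
      exact fun hη => take_eq_of_take_succ_eq hp₁ hη
    rw [hfib, Finset.sum_filter]
  have eA₁ : A₁ = ∑ m ∈ CzF.image (fun η => η.walk.support.take (n + 2)), A m := by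
    rw [Finset.sum_image' (fun η : SAW.DomainSAW Ω δ a z => X ^ η.length * ph η.walk.support)
      ezfib, hCzF, Finset.sum_filter]
  have hsub : CzF.image (fun η => η.walk.support.take (n + 2)) ⊆
      CF.image (fun γ => γ.walk.support.take (n + 2)) := by
    intro m hm
    obtain ⟨η, hη, rfl⟩ := Finset.mem_image.1 hm
    have hp : η.walk.support.take (n + 1) = l := (Finset.mem_filter.1 hη).2
    obtain ⟨γ, hγ⟩ := exists_take_eq_of_noDeadStep hz H η hp
    exact Finset.mem_image.2
      ⟨γ, Finset.mem_filter.2 ⟨Finset.mem_univ _, take_eq_of_take_succ_eq hp hγ⟩, hγ⟩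
  have hzero : ∀ m ∈ CF.image (fun γ => γ.walk.support.take (n + 2)),
      m ∉ CzF.image (fun η => η.walk.support.take (n + 2)) → A m = 0 := by
    intro m hm hm'
    obtain ⟨γ₀, hγ₀, rfl⟩ := Finset.mem_image.1 hm
    have hp₀ : γ₀.walk.support.take (n + 1) = l := (Finset.mem_filter.1 hγ₀).2
    refine Finset.sum_eq_zero fun η _ => if_neg fun hη => hm' ?_
    exact Finset.mem_image.2
      ⟨η, Finset.mem_filter.2 ⟨Finset.mem_univ _, take_eq_of_take_succ_eq hp₀ hη⟩, hη⟩
  rw [eA₁]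
  exact (Finset.sum_subset hsub hzero).symm

/-- **The core identity** `Σ_{γ ∈ C(l)} x_c^{|γ|} M(γ[0,n+1], z) = Σ_{γ ∈ C(l)} x_c^{|γ|} M(γ[0,n], z)`
under the no-dead-step hypothesis. [folklore] -/
theorem sum_cyl_pastObs_succ_eq {Ω : Set ℂ} {δ : ℝ}
    [∀ u w : Site 2, Fintype (SAW.DomainSAW Ω δ u w)]
    {a b z : Site 2} (a' : Site 2) {n : ℕ} {l : List (Site 2)} (hz : z ∉ l)
    (H : ∀ v u : Site 2, l.getLast? = some v → (discreteDomainGraph Ω δ).Adj v u → u ∉ l →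
      (∃ ω : SAW.DomainSAW Ω δ u z, ∀ y ∈ ω.walk.support, y ∉ l) →
      ∃ ω : SAW.DomainSAW Ω δ u b, ∀ y ∈ ω.walk.support, y ∉ l) :
    (∑ γ : SAW.DomainSAW Ω δ a b, if γ.walk.support.take (n + 1) = l then
        (SAW.criticalFugacity : ℂ) ^ γ.length * pastObs Ω δ a' b (prefixAt γ (n + 1)) z else 0) =
      ∑ γ : SAW.DomainSAW Ω δ a b, if γ.walk.support.take (n + 1) = l then
        (SAW.criticalFugacity : ℂ) ^ γ.length * pastObs Ω δ a' b (prefixAt γ n) z else 0 := by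
  by_cases hb : b ∈ l
  · exact sum_cyl_pastObs_succ_eq_of_mem a' z hb
  · exact sum_cyl_pastObs_succ_eq_of_not_mem a' hz hb H


/-! ## S1 -/

/-- **S1 `stub_paraDoobMartingale` (registered stub of the line `parafermionic-martingale`, crux
`SubseqIdentification`, stmt-CriticalPhenomena-0783): the Doob-normalised parafermionic observable
`Q_n = M(γ[0,n], z)/M(γ[0,0], z)` of the critical `δℤ²` self-avoiding walk of `(D; a, b)` is an EXACT
martingale of the exploration on every cylinder `{γ | γ[0,n] = l}` with `z ∉ l` at which no first
step is dead for `b` but alive for `z`:** `∫_{γ ⊒ l} Q_{n+1} dP_δ = ∫_{γ ⊒ l} Q_n dP_δ`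
(first-step decomposition of the observable + domain Markov property of `P_δ ∝ x_c^{|γ|}`; see the
module docstring). [folklore] -/
theorem stub_paraDoobMartingale : ∀ (D : DobrushinDomain) (δ : ℝ) (a a' b z : Site 2) (n : ℕ)
    (l : List (Site 2)), 0 < δ → z ∉ l → l.length = n + 1 →
    (∀ v u : Site 2, l.getLast? = some v → (discreteDomainGraph D.carrier δ).Adj v u → u ∉ l →
      (∃ ω : SAW.DomainSAW D.carrier δ u z, ∀ y ∈ ω.walk.support, y ∉ l) →
      ∃ ω : SAW.DomainSAW D.carrier δ u b, ∀ y ∈ ω.walk.support, y ∉ l) →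
    ∫ γ in {γ : SAW.DomainSAW D.carrier δ a b | γ.walk.support.take (n + 1) = l},
      paraDoob D δ a a' b z γ (n + 1) ∂(SAW.law D.carrier δ a b) =
    ∫ γ in {γ : SAW.DomainSAW D.carrier δ a b | γ.walk.support.take (n + 1) = l},
      paraDoob D δ a a' b z γ n ∂(SAW.law D.carrier δ a b) := by
  intro D δ a a' b z n l hδ hz _ H
  haveI : ∀ u w : Site 2, Fintype (SAW.DomainSAW D.carrier δ u w) := fun u w =>
    @Fintype.ofFinite _ (SAW.finite_domainSAW D.isBounded hδ u w)
  apply setIntegral_law_eq_of_sum_eq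
  simp only [Set.mem_setOf_eq]
  -- the time-`0` denominator only sees the trivial past `[a]`
  have hc : ∀ γ : SAW.DomainSAW D.carrier δ a b, pastObs D.carrier δ a' b (prefixAt γ 0) z =
      pastObs D.carrier δ a' b
        (SimpleGraph.Walk.nil : (discreteDomainGraph D.carrier δ).Walk a a) z := by
    intro γ
    refine SAW.apply_eq_of_support_eq
      (F := fun w (p : (discreteDomainGraph D.carrier δ).Walk a w) => pastObs D.carrier δ a' b p z) ?_
    show (γ.walk.takeUntil _ _).support = _
    rw [SAW.support_takeUntil_getVert γ.isPath 0, SimpleGraph.Walk.support_nil,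
      ← γ.walk.cons_tail_support]
    rfl
  simp only [paraDoob, hc]
  have e : ∀ M : SAW.DomainSAW D.carrier δ a b → ℂ,
      (∑ γ : SAW.DomainSAW D.carrier δ a b, if γ.walk.support.take (n + 1) = l then
          (SAW.criticalFugacity : ℂ) ^ γ.length * (M γ / pastObs D.carrier δ a' b
            (SimpleGraph.Walk.nil : (discreteDomainGraph D.carrier δ).Walk a a) z) else 0) =
        (∑ γ : SAW.DomainSAW D.carrier δ a b, if γ.walk.support.take (n + 1) = l then
          (SAW.criticalFugacity : ℂ) ^ γ.length * M γ else 0) /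
          pastObs D.carrier δ a' b
            (SimpleGraph.Walk.nil : (discreteDomainGraph D.carrier δ).Walk a a) z := by
    intro M
    rw [Finset.sum_div]
    refine Finset.sum_congr rfl fun γ _ => ?_
    split_ifs
    · rw [mul_div_assoc]
    · rw [zero_div]
  rw [e (fun γ => pastObs D.carrier δ a' b (prefixAt γ (n + 1)) z),
    e (fun γ => pastObs D.carrier δ a' b (prefixAt γ n) z), sum_cyl_pastObs_succ_eq a' hz H]

end Summit.CriticalPhenomena.SAWScalingLimit.Theorems.SubseqIdentification.ParaMartingale

end
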